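import Summits.ABC.IUTFork.Cor312LicenceTripleHullCellRefuteTame
import Summits.ABC.IUTFork.Conditional.AbcOfSGenuineKLinUniformRows5
import HarnessLib

/-!
# R-W «W:REF-BANDS-EXACT», OVERLAP triple 1: `2⁵·67⁸·107·22381 + 5⁴·53⁶·353⁵ = 3²²·7¹⁴·43·83` — the hull-level clause S_H is REFUTED at EVERY
# genuine Θ-volume datum for EVERY prime level `5 ≤ l ≤ 1322565`, `l ≠ 67`, at the EXACT local type `e(K_x/ℚ₆₇) = 15·l` (deciding pole `p = 67`)

PROOF-ONLY file (D-0012; 0 definitions, 0 `Prop` facts, no instance) of the abc-iut cell — D-0079 RESCUE sub-cell R-W «WINDOW Θ-SIDE INEQUALITY»,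
seat abc-iut-W-neg-1 (gen 4), row «W:REF-BANDS-EXACT» (abc-iut-plan C-R83 (c): «for each refuted-side N3 triple ONE uniform-in-l REFUTED-as-typed theorem
at the EXACT / genuine-class local types»; this triple is one of the two OVERLAP triples of the R-W numerics lead's GAP-EXACT.tsv b6df69e4392b55b6: the
refuted certificate reaches `l = 1,322,493` while the inhabited certificate starts at `l = 1,322,438`). TAKES NO SIDE on [IUTchIII] Cor. 3.12
(S. Mochizuki, *Inter-universal Teichmüller theory III*, Cor. 3.12 p. 173–174; Step (xi-f) p. 184) or on any author; «refuted as typed» ≠ «refuted in print».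

THE ARITHMETIC (desk files work/cert.py, work/poly.py of this seat; R-W numerics lead's REF-BANDS-EXACT-CERTS.tsv 368bd85925fe47bb row «67 8 15»). At
`p = 67`: `67⁸ ∥ a`, `v₆₇(abc) = 8` is EVEN and coprime to `15`, so the kernel class of the engine `Cor312LicenceTripleHullCellRefuteTame` (`A ∣ 30`,
`15 ∣ 8A`, `A ∣ 15`) is the singleton **`A = 15`: `e(K_x/ℚ₆₇) = 15·l` at every fibre point of every genuine datum, BY THEOREM** (abc-iut-w4-d087's parity
lemma + abc-iut-W-neg-1's Tate root; no local-type hypothesis). The top-label hull cell (`j = l⋆ = (l−1)/2`, `e = 15l`, `P_q = 120`,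
`r_in = ⌊15l/66⌋ + 1`, `r_out = 67^{a₀} − a₀·15l`) FAILS on the three turning-point pieces `a₀ = 1` (`l ≤ 294`), `a₀ = 2` (`295 ≤ l ≤ 19751`),
`a₀ = 3` (`19752 ≤ l ≤ 1322565`): with `l = 2k + 3` and `66·r_in ≤ 15l + 66` the floor-free margin `66·(cell slack)` is bounded below by
`D₁(k) = 3930k² + 6297k − 3192`, `D₂(k) = 1950k² + 291219k + 574572`, `D₃(k) = −30k² + 19838373k + 39676800` respectively, each `≥ 0` on its piece
(`D₃` is concave; `D₃(9875) = 193,018,141,425`, `D₃(661281) = 1,983,783`; the exact cell first holds at `l = 1,322,641`). Hence for EVERY prime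
`5 ≤ l ≤ 1,322,565`, `l ≠ 67` (so `67 ∉ {2,3,5,l}`): S_H FAILS at every genuine Θ-volume datum over `(ratPoint (a/c), l)` — extending abc-iut-W-num-6's
e-free [LIN] band `GenuineK.not_pilotKummerCompatHull_chosen_frey31117999167337103924704_band` (`6 ≤ l ≤ 3361`, p-id of `AbcOfSGenuineKLinUniformBandRows5`)
by the factor `393` in `l`.

WHAT IS PROVED (namespace `Summit.ABC.IUTFork.Conditional`):
* §1 `WRow.factorization_frey31117999167337103924704_sixtySeven` (`v₆₇ = 8`); `WRow.refBandClass_sixtySeven_eight` (the class is `{15}`);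
  `WRow.not_hullCell_of_le` (floor-free sufficient condition for a failing column); **`WRow.refBandCells_frey31117999167337103924704_sixtySeven`**
  (the failing cells for every odd `5 ≤ l ≤ 1322565`, three pieces, `nlinarith` on the polynomial certificates).
* §2 **`WRow.not_licence_frey31117999167337103924704_refBand`** — EVERY prime `5 ≤ l ≤ 1322565`, `l ≠ 67`, EVERY genuine Θ-volume datum `T` at
  `(ratPoint (a/c), l)`, EVERY pair of realising Θ- and q-ideles: `¬ Thm311ToCor312.Licence (settingPrVolSharp (pilotDataOfK T.D T.K) …)`;
  **`WRow.not_exists_qPinned_and_hull_frey31117999167337103924704_refBand`** — branch C's antecedent FAILS (any columns);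
  **`GenuineK.not_pilotKummerCompatHull_chosen_frey31117999167337103924704_refBand`** — the W-lane row shape (chosen ideles, pinned reading, every free
  binder). NO local-type hypothesis.
READING (neutral; numbers, not adjectives): the R-W table's refuted side for this triple is ONE theorem on the whole band; the level `l = 67` and the
levels `l > 1,322,565` are NOT covered here (R-W numerics: inhabited certificate from `l = 1,322,438`). Admissibility / Szpiro-badness / (P6) /
NON-EMPTINESS of `(ratPoint (a/c), l)` are NOT claimed. HONEST SCOPE: OUR sharp containers and Dupuy–Hilado's typed (Ind1)/(Ind2); STRONGER-THAN-PRINT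
hull reading; nothing about the printed inequality, the number-level corollary or any author's intended hull; typed ≠ proved; instantiated ≠ endorsed;
no abc claim. [cite: Mochizuki2012, IUTchI Ex. 3.2 (iv) p. 71; IUTchIII Cor. 3.12 Step (xi-f) p. 184; IUTchIV Prop. 1.1 p. 9, Prop. 1.2 (i)(ii) p. 10, Cor. 2.2 (ii) proof (P5) p. 46]
[cite: DupuyHilado2025, §3.3, §3.4, §4.9, §4.12] [cite: SilvermanAEC2009, Prop. III.1.7(b)] [claim: Mochizuki2012, status: disputed] for every IUT sentence.
-/

noncomputable section

open Set Function Metric NumberField IsDedekindDomain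

namespace Summit.ABC.IUTFork.Conditional

open Thm311 Thm311.Real Cor312 Cor312Vol Cor312Prov Literature.IUT.LogThetaLattice Literature.IUT.LogVolume
  Literature.IUT.HodgeTheaters Literature.IUT.LogVolume.Cor22 Literature.IUT.LogVolume.ThetaData
open Literature.NumberTheory.NumberFields Literature.NumberTheory.GaloisRepresentations.Ultrametric
open Literature.NumberTheory.DiophantineGeometry Literature.NumberTheory.DiophantineGeometry.GenEll
open Summit.ABC.IUTFork.Repair.RH.HullThresholdExact Summit.ABC.IUTFork.Repair.RH.HullThresholdExactRefute

/-! ## §1. Arithmetic: `v₆₇(abc) = 8`, the class `{15}`, and the failing top-label cells on the three turning-point pieces -/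

/-- `v_p(n) = k` from `n = p^k·m` with `p ∤ m`. [folklore] -/
private theorem factorization_eq_of_eq_pow_mul₆₇ {p k m n : ℕ} (hp : p.Prime) (hn : n = p ^ k * m) (hm : ¬ p ∣ m) :
    n.factorization p = k := by
  subst hn
  have hm0 : m ≠ 0 := fun h => hm (h ▸ dvd_zero p)
  rw [Nat.factorization_mul (pow_ne_zero _ hp.ne_zero) hm0, Finsupp.add_apply, hp.factorization_pow, Finsupp.single_eq_same,
    Nat.factorization_eq_zero_of_not_dvd hm, add_zero]

/-- `v₆₇(abc) = 8` for `abc = (2⁵·67⁸·107·22381)·(5⁴·53⁶·353⁵)·(3²²·7¹⁴·43·83)` (`67⁸ ∥ a`). [folklore] -/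
theorem WRow.factorization_frey31117999167337103924704_sixtySeven :
    (2 ^ 5 * 67 ^ 8 * 107 * 22381 * (5 ^ 4 * 53 ^ 6 * 353 ^ 5) * (3 ^ 22 * 7 ^ 14 * 43 * 83)).factorization 67 = 8 :=
  factorization_eq_of_eq_pow_mul₆₇ (m := 2 ^ 5 * 107 * 22381 * (5 ^ 4 * 53 ^ 6 * 353 ^ 5) * (3 ^ 22 * 7 ^ 14 * 43 * 83))
    (by norm_num) (by ring) (by norm_num)

/-- **The kernel class at `(p, v) = (67, 8)` is `{15}`**: `A ∣ 30`, `15 ∣ 8·A` (so `15 ∣ A`) and `A ∣ 15` (parity, `8` even) force `A = 15`. [folklore] -/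
theorem WRow.refBandClass_sixtySeven_eight {A : ℕ} (_h30 : A ∣ 30) (h15 : 15 ∣ A * 8) (hev : Even 8 → A ∣ 15) : A = 15 :=
  Nat.dvd_antisymm (hev ⟨4, rfl⟩) ((Nat.Coprime.dvd_of_dvd_mul_right (by norm_num : Nat.Coprime 15 8) h15))

/-- **Floor-free sufficient condition for a FAILING column**: since `e·⌊X/e⌋ > X − e`, the inequality `m − (j+1)·r_out + e ≤ X`
(`X = j²m − j(e−1) − (j+1)r_in`) refutes `HullCell e m j r_in r_out` (`e·⌊X/e⌋ ≤ m − (j+1)·r_out`). Pure integer arithmetic. [folklore] -/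
theorem WRow.not_hullCell_of_le {e m j rin rout : ℤ} (he : 0 < e)
    (h : m - (j + 1) * rout + e ≤ j ^ 2 * m - j * (e - 1) - (j + 1) * rin) : ¬ HullCell e m j rin rout := by
  unfold HullCell
  intro hc
  have h1 := Int.mul_ediv_add_emod (j ^ 2 * m - j * (e - 1) - (j + 1) * rin) e
  have h2 := Int.emod_lt_of_pos (j ^ 2 * m - j * (e - 1) - (j + 1) * rin) he
  linarith

/-- **The failing cells of the band** at `(p, A, P_q) = (67, 15, 120)`, top label `j = (l−1)/2`, for EVERY odd `5 ≤ l ≤ 1322565`: a turning point `a₀ ∈ {1, 2, 3}`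
(`67^s·66 < 15l` for `s < a₀`, `15l ≤ 67^{a₀}·66`) with `¬ HullCell (15l) 120 ((l−1)/2) (⌊15l/66⌋+1) (67^{a₀} − a₀·15l)`. Per piece: `WRow.not_hullCell_of_le` and
the polynomial certificate `D_{a₀}(k) ≥ 0` (`l = 2k+3`, `66·⌊15l/66⌋ ≤ 15l`) by `nlinarith` (module docstring). [folklore] -/
theorem WRow.refBandCells_frey31117999167337103924704_sixtySeven (l : ℕ) (h5 : 5 ≤ l) (hhi : l ≤ 1322565) (hodd : l % 2 = 1) :
    ∃ a₀ : ℕ, (∀ s : ℕ, s < a₀ → (1 : ℤ) * ((67 : ℕ) : ℤ) ^ s * (((67 : ℕ) : ℤ) - 1) < ((15 * l : ℕ) : ℤ)) ∧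
      ((15 * l : ℕ) : ℤ) ≤ 1 * ((67 : ℕ) : ℤ) ^ a₀ * (((67 : ℕ) : ℤ) - 1) ∧
      ¬ HullCell ((15 * l : ℕ) : ℤ) ((15 * 8 : ℕ) : ℤ) ((((l - 1) / 2 - 1 : ℕ) : ℤ) + 1) (((15 * l) / ((67 : ℕ) - 1) + 1 : ℕ) : ℤ)
        (((67 : ℕ) : ℤ) ^ a₀ - (a₀ : ℤ) * ((15 * l : ℕ) : ℤ)) := by
  have hk : 2 * ((l - 1) / 2 - 1) + 3 = l := by omega
  have hr : 66 * (15 * l / ((67 : ℕ) - 1)) ≤ 15 * l := by omega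
  generalize (l - 1) / 2 - 1 = k at hk ⊢
  generalize 15 * l / ((67 : ℕ) - 1) = r at hr ⊢
  have hkz : (2 * k + 3 : ℤ) = l := by exact_mod_cast hk
  have hrz : (66 * r : ℤ) ≤ 15 * l := by exact_mod_cast hr
  have hk0 : (0 : ℤ) ≤ k := by positivity
  rcases le_or_gt l 294 with h1 | h1
  · refine ⟨1, fun s hs => ?_, ?_, WRow.not_hullCell_of_le (by positivity) ?_⟩
    · interval_cases s; push_cast; omega
    · push_cast; omega
    · have h1z : (l : ℤ) ≤ 294 := by exact_mod_cast h1
      have hk1 : (1 : ℤ) ≤ k := by linarith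
      push_cast
      nlinarith [mul_nonneg hk0 (sub_nonneg.2 hrz), sub_nonneg.2 hrz, mul_nonneg (sub_nonneg.2 hk1) (sub_nonneg.2 hk1)]
  rcases le_or_gt l 19751 with h2 | h2
  · refine ⟨2, fun s hs => ?_, ?_, WRow.not_hullCell_of_le (by positivity) ?_⟩
    · interval_cases s <;> push_cast <;> omega
    · push_cast; omega
    · have hlo : (295 : ℤ) ≤ l := by exact_mod_cast h1
      have hk1 : (146 : ℤ) ≤ k := by linarith
      push_cast
      nlinarith [mul_nonneg hk0 (sub_nonneg.2 hrz), sub_nonneg.2 hrz, mul_nonneg (sub_nonneg.2 hk1) (sub_nonneg.2 hk1)]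
  · refine ⟨3, fun s hs => ?_, ?_, WRow.not_hullCell_of_le (by positivity) ?_⟩
    · interval_cases s <;> push_cast <;> omega
    · push_cast; omega
    · have hlo : (19752 : ℤ) ≤ l := by exact_mod_cast h2
      have hhiz : (l : ℤ) ≤ 1322565 := by exact_mod_cast hhi
      have hk1 : (9875 : ℤ) ≤ k := by linarith
      have hk2 : (k : ℤ) ≤ 661281 := by linarith
      push_cast
      nlinarith [mul_nonneg hk0 (sub_nonneg.2 hrz), sub_nonneg.2 hrz, mul_nonneg (sub_nonneg.2 hk1) (sub_nonneg.2 hk2),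
        sub_nonneg.2 hk1, sub_nonneg.2 hk2]

/-! ## §2. The band: S_H REFUTED at every genuine datum, every prime `5 ≤ l ≤ 1322565`, `l ≠ 67` -/

/-- **«W:REF-BANDS-EXACT», OVERLAP TRIPLE 1, licence level**: `2⁵·67⁸·107·22381 + 5⁴·53⁶·353⁵ = 3²²·7¹⁴·43·83`, EVERY prime `5 ≤ l ≤ 1322565` with `l ≠ 67`,
EVERY genuine Θ-volume datum `T` at `(ratPoint (a/c), l)`, EVERY pair of Θ- and q-ideles realising the pilot divisors of `X := pilotDataOfK T.D T.K`:
abc-iut-c312-1's `Thm311ToCor312.Licence` FAILS at abc-iut-c312-7's `settingPrVolSharp X …` — the class-robust engine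
`WRow.not_licence_triple_of_hullCells_tame` at `(p, v, i) = (67, 8, (l−1)/2 − 1)` with the class `{15}` (§1) and the cells of §1; NO local-type hypothesis.
[cite: Mochizuki2012, IUTchI Ex. 3.2 (iv) p. 71; IUTchIII Cor. 3.12 Step (xi-f) p. 184; IUTchIV Prop. 1.1 p. 9, Prop. 1.2 (i)(ii) p. 10, Cor. 2.2 (ii) proof (P5) p. 46]
[cite: DupuyHilado2025, §3.4, §4.9, §4.12] [claim: Mochizuki2012, status: disputed] -/
theorem WRow.not_licence_frey31117999167337103924704_refBand {l : ℕ} (hl : l.Prime) (h5 : 5 ≤ l) (hhi : l ≤ 1322565) (h67 : l ≠ 67)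
    (T : Cor22.ThetaVolumeDatumAt (ratPoint (((2 ^ 5 * 67 ^ 8 * 107 * 22381 : ℕ) : ℚ) / (3 ^ 22 * 7 ^ 14 * 43 * 83 : ℕ))) l) :
    letI := T.instFieldF; letI := T.instNumberFieldF; letI := T.instAlgebraF; letI := T.instFieldK
    letI := T.instNumberFieldK; letI := T.instAlgebraK; letI := T.instFieldFbar; letI := T.instAlgebraFbar
    letI := T.instAlgebraKFbar; letI := T.instIsElliptic
    ∀ {logv : PadicLogs T.K} (hlog : LogvAnalytic logv) (M : Type) [Field M] [NumberField M]
      (archPk : ∀ (j : (thetaIndex (pilotDataOfK T.D T.K)).Label) (vQ : (thetaIndex (pilotDataOfK T.D T.K)).VQ),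
        Set ((logShellsDH (pilotDataOfK T.D T.K) logv).Packet j vQ))
      (archSub : ∀ (j : (thetaIndex (pilotDataOfK T.D T.K)).Label) (v : (thetaIndex (pilotDataOfK T.D T.K)).V),
        Set ((logShellsDH (pilotDataOfK T.D T.K) logv).Packet j ((thetaIndex (pilotDataOfK T.D T.K)).over v)))
      (Ψ : ℤ → ∀ v : (thetaIndex (pilotDataOfK T.D T.K)).V, v ∈ (thetaIndex (pilotDataOfK T.D T.K)).Vbad →
        Set ((logShellsDH (pilotDataOfK T.D T.K) logv).StarPacket v))
      (act : ℤ → ∀ v : (thetaIndex (pilotDataOfK T.D T.K)).V, v ∈ (thetaIndex (pilotDataOfK T.D T.K)).Vbad →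
        (logShellsDH (pilotDataOfK T.D T.K) logv).StarPacket v → Module.End ℚ ((logShellsDH (pilotDataOfK T.D T.K) logv).StarPacket v))
      (Mmod : ℤ → ∀ j : (thetaIndex (pilotDataOfK T.D T.K)).LabelStar, Set ((logShellsDH (pilotDataOfK T.D T.K) logv).GlobalPacket j.1))
      (region : ℤ → ∀ j : (thetaIndex (pilotDataOfK T.D T.K)).LabelStar, FinDivisor M → ∀ vQ : (thetaIndex (pilotDataOfK T.D T.K)).VQ,
        Set ((logShellsDH (pilotDataOfK T.D T.K) logv).Packet j.1 vQ))
      (n : ℤ) {HT : Type} {LogLink : HT → HT → Type} {IsFull : ∀ {s t : HT}, LogLink s t → Prop}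
      (lat : LGPGaussianLogThetaLattice LogLink IsFull)
      {Frd : Type} {IsoF : Frd → Frd → Type} {Ob : Frd → Type} {realify : Frd → Frd} {Strip : Type}
      {IsoS : Strip → Strip → Type} {Mv : ∀ v : (thetaIndex (pilotDataOfK T.D T.K)).V, v ∈ (thetaIndex (pilotDataOfK T.D T.K)).Vbad → Type}
      [∀ v h, Monoid (Mv v h)]
      (sig : GlobalLGPFrobenioidSignature (thetaIndex (pilotDataOfK T.D T.K)).lstar (thetaIndex (pilotDataOfK T.D T.K)).V
        (· ∈ (thetaIndex (pilotDataOfK T.D T.K)).Vbad) Frd IsoF Ob realify Strip IsoS Mv)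
      (split : SplittingMonoids Mv) {ObΔ : Type} {N : ∀ v : (thetaIndex (pilotDataOfK T.D T.K)).V, v ∈ (thetaIndex (pilotDataOfK T.D T.K)).Vbad → Type}
      [∀ v h, Monoid (N v h)] (qData : QPilotData ObΔ N)
      (tq : ∀ (pp : Nat.Primes) (x : (thetaIndex (pilotDataOfK T.D T.K)).Fibre (.inr pp)),
        haveI : Fact (pp : ℕ).Prime := ⟨pp.2⟩; kOf (pilotDataOfK T.D T.K) pp.1 x)
      (t : ∀ (pp : Nat.Primes) (_ : Fin (pilotDataOfK T.D T.K).lstar) (x : (thetaIndex (pilotDataOfK T.D T.K)).Fibre (.inr pp)),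
        haveI : Fact (pp : ℕ).Prime := ⟨pp.2⟩; kOf (pilotDataOfK T.D T.K) pp.1 x)
      (htq0 : ∀ pp x, tq pp x ≠ 0)
      (htq1 : ∀ (pp : Nat.Primes) (x : (thetaIndex (pilotDataOfK T.D T.K)).Fibre (.inr pp)),
        haveI : Fact (pp : ℕ).Prime := ⟨pp.2⟩; placeOf (pilotDataOfK T.D T.K) pp.1 x ∉ (pilotDataOfK T.D T.K).S → ‖tq pp x‖ = 1)
      (_ht0 : ∀ pp i x, t pp i x ≠ 0)
      (_ht : ∀ (pp : Nat.Primes) (i : Fin (pilotDataOfK T.D T.K).lstar) (x : (thetaIndex (pilotDataOfK T.D T.K)).Fibre (.inr pp)),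
        haveI : Fact (pp : ℕ).Prime := ⟨pp.2⟩
        Real.log ‖t pp i x‖ = -((pilotDataOfK T.D T.K).thetaPilot i (placeOf (pilotDataOfK T.D T.K) pp.1 x)) *
          logNorm T.K (placeOf (pilotDataOfK T.D T.K) pp.1 x) / localDegree T.K (placeOf (pilotDataOfK T.D T.K) pp.1 x))
      (_htq : ∀ (pp : Nat.Primes) (x : (thetaIndex (pilotDataOfK T.D T.K)).Fibre (.inr pp)),
        haveI : Fact (pp : ℕ).Prime := ⟨pp.2⟩
        Real.log ‖tq pp x‖ = -((pilotDataOfK T.D T.K).qPilot (placeOf (pilotDataOfK T.D T.K) pp.1 x)) *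
          logNorm T.K (placeOf (pilotDataOfK T.D T.K) pp.1 x) / localDegree T.K (placeOf (pilotDataOfK T.D T.K) pp.1 x)),
      ¬ Thm311ToCor312.Licence
        (settingPrVolSharp (pilotDataOfK T.D T.K) hlog M archPk archSub Ψ act Mmod region n lat sig split qData tq t htq0 htq1) := by
  letI := T.instFieldF; letI := T.instNumberFieldF; letI := T.instAlgebraF; letI := T.instFieldK
  letI := T.instNumberFieldK; letI := T.instAlgebraK; letI := T.instFieldFbar; letI := T.instAlgebraFbar
  letI := T.instAlgebraKFbar; letI := T.instIsElliptic
  have hp : Nat.Prime 67 := by norm_num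
  have hodd : l % 2 = 1 := by
    rcases hl.eq_two_or_odd with h | h
    · omega
    · exact h
  intro logv hlog M _ _ archPk archSub Ψ act Mmod region n HT LogLink IsFull lat Frd IsoF Ob realify Strip
    IsoS Mv _ sig split ObΔ N _ qData tq t htq0 htq1 ht0 ht htq
  exact WRow.not_licence_triple_of_hullCells_tame isABCTriple_frey31117999167337103924704 T ⟨67, hp⟩ (by norm_num) (by norm_num)
    (by norm_num) (fun h => h67 h.symm) (by show (67 : ℕ) ∣ _; norm_num) WRow.factorization_frey31117999167337103924704_sixtySeven
    (i := (l - 1) / 2 - 1) (by omega)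
    (fun A h30 h15 hev => by
      obtain rfl : A = 15 := WRow.refBandClass_sixtySeven_eight h30 h15 hev
      exact WRow.refBandCells_frey31117999167337103924704_sixtySeven l h5 hhi hodd) hlog M archPk archSub Ψ act Mmod
    region n lat sig split qData tq t htq0 htq1 ht0 ht htq

/-- **… branch C's per-datum antecedent «∃ ρ qK, QPinned ∧ PilotKummerCompatHull» FAILS** at every genuine Θ-volume datum over `(ratPoint (a/c), l)`,
every prime `5 ≤ l ≤ 1322565`, `l ≠ 67`, for ANY columns and EVERY pair of realising ideles (`WRow.not_exists_qPinned_and_hull_triple_of_hullCells_tame`).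
[cite: Mochizuki2012, IUTchIII Cor. 3.12 Step (xi-d) p. 183, (xi-f) p. 184] [cite: DupuyHilado2025, §3.4, §4.9, §4.12] [claim: Mochizuki2012, status: disputed] -/
theorem WRow.not_exists_qPinned_and_hull_frey31117999167337103924704_refBand {l : ℕ} (hl : l.Prime) (h5 : 5 ≤ l) (hhi : l ≤ 1322565)
    (h67 : l ≠ 67) (T : Cor22.ThetaVolumeDatumAt (ratPoint (((2 ^ 5 * 67 ^ 8 * 107 * 22381 : ℕ) : ℚ) / (3 ^ 22 * 7 ^ 14 * 43 * 83 : ℕ))) l) :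
    letI := T.instFieldF; letI := T.instNumberFieldF; letI := T.instAlgebraF; letI := T.instFieldK
    letI := T.instNumberFieldK; letI := T.instAlgebraK; letI := T.instFieldFbar; letI := T.instAlgebraFbar
    letI := T.instAlgebraKFbar; letI := T.instIsElliptic
    ∀ {logv : PadicLogs T.K} (hlog : LogvAnalytic logv) (M : Type) [Field M] [NumberField M]
      (archPk : ∀ (j : (thetaIndex (pilotDataOfK T.D T.K)).Label) (vQ : (thetaIndex (pilotDataOfK T.D T.K)).VQ),
        Set ((logShellsDH (pilotDataOfK T.D T.K) logv).Packet j vQ))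
      (archSub : ∀ (j : (thetaIndex (pilotDataOfK T.D T.K)).Label) (v : (thetaIndex (pilotDataOfK T.D T.K)).V),
        Set ((logShellsDH (pilotDataOfK T.D T.K) logv).Packet j ((thetaIndex (pilotDataOfK T.D T.K)).over v)))
      (Ψ : ℤ → ∀ v : (thetaIndex (pilotDataOfK T.D T.K)).V, v ∈ (thetaIndex (pilotDataOfK T.D T.K)).Vbad →
        Set ((logShellsDH (pilotDataOfK T.D T.K) logv).StarPacket v))
      (act : ℤ → ∀ v : (thetaIndex (pilotDataOfK T.D T.K)).V, v ∈ (thetaIndex (pilotDataOfK T.D T.K)).Vbad →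
        (logShellsDH (pilotDataOfK T.D T.K) logv).StarPacket v → Module.End ℚ ((logShellsDH (pilotDataOfK T.D T.K) logv).StarPacket v))
      (Mmod : ℤ → ∀ j : (thetaIndex (pilotDataOfK T.D T.K)).LabelStar, Set ((logShellsDH (pilotDataOfK T.D T.K) logv).GlobalPacket j.1))
      (region : ℤ → ∀ j : (thetaIndex (pilotDataOfK T.D T.K)).LabelStar, FinDivisor M → ∀ vQ : (thetaIndex (pilotDataOfK T.D T.K)).VQ,
        Set ((logShellsDH (pilotDataOfK T.D T.K) logv).Packet j.1 vQ))
      (n : ℤ) {HT : Type} {LogLink : HT → HT → Type} {IsFull : ∀ {s t : HT}, LogLink s t → Prop}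
      (lat : LGPGaussianLogThetaLattice LogLink IsFull)
      {Frd : Type} {IsoF : Frd → Frd → Type} {Ob : Frd → Type} {realify : Frd → Frd} {Strip : Type}
      {IsoS : Strip → Strip → Type} {Mv : ∀ v : (thetaIndex (pilotDataOfK T.D T.K)).V, v ∈ (thetaIndex (pilotDataOfK T.D T.K)).Vbad → Type}
      [∀ v h, Monoid (Mv v h)]
      (sig : GlobalLGPFrobenioidSignature (thetaIndex (pilotDataOfK T.D T.K)).lstar (thetaIndex (pilotDataOfK T.D T.K)).V
        (· ∈ (thetaIndex (pilotDataOfK T.D T.K)).Vbad) Frd IsoF Ob realify Strip IsoS Mv)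
      (split : SplittingMonoids Mv) {ObΔ : Type} {N : ∀ v : (thetaIndex (pilotDataOfK T.D T.K)).V, v ∈ (thetaIndex (pilotDataOfK T.D T.K)).Vbad → Type}
      [∀ v h, Monoid (N v h)] (qData : QPilotData ObΔ N)
      (tq : ∀ (pp : Nat.Primes) (x : (thetaIndex (pilotDataOfK T.D T.K)).Fibre (.inr pp)),
        haveI : Fact (pp : ℕ).Prime := ⟨pp.2⟩; kOf (pilotDataOfK T.D T.K) pp.1 x)
      (t : ∀ (pp : Nat.Primes) (_ : Fin (pilotDataOfK T.D T.K).lstar) (x : (thetaIndex (pilotDataOfK T.D T.K)).Fibre (.inr pp)),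
        haveI : Fact (pp : ℕ).Prime := ⟨pp.2⟩; kOf (pilotDataOfK T.D T.K) pp.1 x)
      (htq0 : ∀ pp x, tq pp x ≠ 0)
      (htq1 : ∀ (pp : Nat.Primes) (x : (thetaIndex (pilotDataOfK T.D T.K)).Fibre (.inr pp)),
        haveI : Fact (pp : ℕ).Prime := ⟨pp.2⟩; placeOf (pilotDataOfK T.D T.K) pp.1 x ∉ (pilotDataOfK T.D T.K).S → ‖tq pp x‖ = 1)
      (col : ℤ → Column (logShellsDH (pilotDataOfK T.D T.K) logv))
      (_ht0 : ∀ pp i x, t pp i x ≠ 0)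
      (_ht : ∀ (pp : Nat.Primes) (i : Fin (pilotDataOfK T.D T.K).lstar) (x : (thetaIndex (pilotDataOfK T.D T.K)).Fibre (.inr pp)),
        haveI : Fact (pp : ℕ).Prime := ⟨pp.2⟩
        Real.log ‖t pp i x‖ = -((pilotDataOfK T.D T.K).thetaPilot i (placeOf (pilotDataOfK T.D T.K) pp.1 x)) *
          logNorm T.K (placeOf (pilotDataOfK T.D T.K) pp.1 x) / localDegree T.K (placeOf (pilotDataOfK T.D T.K) pp.1 x))
      (_htq : ∀ (pp : Nat.Primes) (x : (thetaIndex (pilotDataOfK T.D T.K)).Fibre (.inr pp)),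
        haveI : Fact (pp : ℕ).Prime := ⟨pp.2⟩
        Real.log ‖tq pp x‖ = -((pilotDataOfK T.D T.K).qPilot (placeOf (pilotDataOfK T.D T.K) pp.1 x)) *
          logNorm T.K (placeOf (pilotDataOfK T.D T.K) pp.1 x) / localDegree T.K (placeOf (pilotDataOfK T.D T.K) pp.1 x)),
      ¬ ∃ (ρ : (∀ v : (thetaIndex (pilotDataOfK T.D T.K)).V, v ∈ (thetaIndex (pilotDataOfK T.D T.K)).Vbad →
              Set ((logShellsDH (pilotDataOfK T.D T.K) logv).StarPacket v)) →
            ∀ (j : (thetaIndex (pilotDataOfK T.D T.K)).Label) (vQ : (thetaIndex (pilotDataOfK T.D T.K)).VQ),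
              Set ((logShellsDH (pilotDataOfK T.D T.K) logv).Packet j vQ))
          (qK : ∀ v : (thetaIndex (pilotDataOfK T.D T.K)).V, v ∈ (thetaIndex (pilotDataOfK T.D T.K)).Vbad →
            Set ((logShellsDH (pilotDataOfK T.D T.K) logv).StarPacket v)),
          QPinned ({ toSituation := situationPrVol (pilotDataOfK T.D T.K) hlog M archPk archSub Ψ act Mmod region, col := col } :
              LatticeSituation (thetaIndex (pilotDataOfK T.D T.K)))
            (settingPrVolSharp (pilotDataOfK T.D T.K) hlog M archPk archSub Ψ act Mmod region n lat sig split qData tq t htq0 htq1) ρ qK ∧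
          PilotKummerCompatHull ({ toSituation := situationPrVol (pilotDataOfK T.D T.K) hlog M archPk archSub Ψ act Mmod region, col := col } :
              LatticeSituation (thetaIndex (pilotDataOfK T.D T.K)))
            (settingPrVolSharp (pilotDataOfK T.D T.K) hlog M archPk archSub Ψ act Mmod region n lat sig split qData tq t htq0 htq1) ρ qK := by
  letI := T.instFieldF; letI := T.instNumberFieldF; letI := T.instAlgebraF; letI := T.instFieldK
  letI := T.instNumberFieldK; letI := T.instAlgebraK; letI := T.instFieldFbar; letI := T.instAlgebraFbar
  letI := T.instAlgebraKFbar; letI := T.instIsElliptic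
  have hp : Nat.Prime 67 := by norm_num
  have hodd : l % 2 = 1 := by
    rcases hl.eq_two_or_odd with h | h
    · omega
    · exact h
  intro logv hlog M _ _ archPk archSub Ψ act Mmod region n HT LogLink IsFull lat Frd IsoF Ob realify Strip
    IsoS Mv _ sig split ObΔ N _ qData tq t htq0 htq1 col ht0 ht htq
  exact WRow.not_exists_qPinned_and_hull_triple_of_hullCells_tame isABCTriple_frey31117999167337103924704 T ⟨67, hp⟩ (by norm_num)
    (by norm_num) (by norm_num) (fun h => h67 h.symm) (by show (67 : ℕ) ∣ _; norm_num)
    WRow.factorization_frey31117999167337103924704_sixtySeven (i := (l - 1) / 2 - 1) (by omega)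
    (fun A h30 h15 hev => by
      obtain rfl : A = 15 := WRow.refBandClass_sixtySeven_eight h30 h15 hev
      exact WRow.refBandCells_frey31117999167337103924704_sixtySeven l h5 hhi hodd) hlog M archPk archSub Ψ act Mmod
    region n lat sig split qData tq t htq0 htq1 col ht0 ht htq

/-- **… and in the W-lane ROW SHAPE (R-W rows `pilotDataOfK:frey-31117999167337103924704-…:l`, EVERY prime `5 ≤ l ≤ 1322565`, `l ≠ 67` — REFUTED side,
UNCONDITIONALLY, at the EXACT local type BY THEOREM)**: for every genuine Θ-volume datum `T` over `(ratPoint (a/c), l)` and EVERY choice of the free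
context binders and Kummer datum, `Cor312Vol.PilotKummerCompatHull` at `settingPrVolSharp (pilotDataOfK T.D T.K) …` with the CHOSEN realising ideles and
the PINNED reading FAILS (`GenuineK.not_pilotKummerCompatHull_chosen_triple_of_hullCells_tame`). Admissibility / Szpiro-badness / (P6) / non-emptiness NOT
claimed. [cite: Mochizuki2012, IUTchIII Cor. 3.12 Step (xi-f) p. 184; IUTchIV Prop. 1.1 p. 9, Prop. 1.2 (i)(ii) p. 10] [cite: DupuyHilado2025, §3.4, §4.9, §4.12]
[claim: Mochizuki2012, status: disputed] -/
theorem GenuineK.not_pilotKummerCompatHull_chosen_frey31117999167337103924704_refBand {l : ℕ} (hl : l.Prime) (h5 : 5 ≤ l)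
    (hhi : l ≤ 1322565) (h67 : l ≠ 67)
    (T : Cor22.ThetaVolumeDatumAt (ratPoint (((2 ^ 5 * 67 ^ 8 * 107 * 22381 : ℕ) : ℚ) / (3 ^ 22 * 7 ^ 14 * 43 * 83 : ℕ))) l) :
    letI := T.instFieldF; letI := T.instNumberFieldF; letI := T.instAlgebraF; letI := T.instFieldK
    letI := T.instNumberFieldK; letI := T.instAlgebraK; letI := T.instFieldFbar; letI := T.instAlgebraFbar
    letI := T.instAlgebraKFbar; letI := T.instIsElliptic
    ∀ (M : Type) [Field M] [NumberField M]
      (archPk : ∀ (j : (thetaIndex (pilotDataOfK T.D T.K)).Label) (vQ : (thetaIndex (pilotDataOfK T.D T.K)).VQ),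
        Set ((logShellsDH (pilotDataOfK T.D T.K) (analyticLogv T.K)).Packet j vQ))
      (archSub : ∀ (j : (thetaIndex (pilotDataOfK T.D T.K)).Label) (v : (thetaIndex (pilotDataOfK T.D T.K)).V),
        Set ((logShellsDH (pilotDataOfK T.D T.K) (analyticLogv T.K)).Packet j ((thetaIndex (pilotDataOfK T.D T.K)).over v)))
      (Ψ : ℤ → ∀ v : (thetaIndex (pilotDataOfK T.D T.K)).V, v ∈ (thetaIndex (pilotDataOfK T.D T.K)).Vbad →
        Set ((logShellsDH (pilotDataOfK T.D T.K) (analyticLogv T.K)).StarPacket v))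
      (act : ℤ → ∀ v : (thetaIndex (pilotDataOfK T.D T.K)).V, v ∈ (thetaIndex (pilotDataOfK T.D T.K)).Vbad →
        (logShellsDH (pilotDataOfK T.D T.K) (analyticLogv T.K)).StarPacket v →
          Module.End ℚ ((logShellsDH (pilotDataOfK T.D T.K) (analyticLogv T.K)).StarPacket v))
      (Mmod : ℤ → ∀ j : (thetaIndex (pilotDataOfK T.D T.K)).LabelStar,
        Set ((logShellsDH (pilotDataOfK T.D T.K) (analyticLogv T.K)).GlobalPacket j.1))
      (region : ℤ → ∀ j : (thetaIndex (pilotDataOfK T.D T.K)).LabelStar, FinDivisor M →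
        ∀ vQ : (thetaIndex (pilotDataOfK T.D T.K)).VQ, Set ((logShellsDH (pilotDataOfK T.D T.K) (analyticLogv T.K)).Packet j.1 vQ))
      (frobAdm : ℤ → ℤ → ∀ (j : (thetaIndex (pilotDataOfK T.D T.K)).Label) (vQ : (thetaIndex (pilotDataOfK T.D T.K)).VQ),
        Set ((logShellsDH (pilotDataOfK T.D T.K) (analyticLogv T.K)).Packet j vQ) → Prop)
      (frobLogvol : ℤ → ℤ → ∀ (j : (thetaIndex (pilotDataOfK T.D T.K)).Label) (vQ : (thetaIndex (pilotDataOfK T.D T.K)).VQ),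
        Set ((logShellsDH (pilotDataOfK T.D T.K) (analyticLogv T.K)).Packet j vQ) → ℝ)
      (frobΨ : ℤ → ℤ → ∀ v : (thetaIndex (pilotDataOfK T.D T.K)).V, v ∈ (thetaIndex (pilotDataOfK T.D T.K)).Vbad →
        Set ((logShellsDH (pilotDataOfK T.D T.K) (analyticLogv T.K)).StarPacket v))
      (frobMmod : ℤ → ℤ → ∀ j : (thetaIndex (pilotDataOfK T.D T.K)).LabelStar,
        Set ((logShellsDH (pilotDataOfK T.D T.K) (analyticLogv T.K)).GlobalPacket j.1))
      (unitImage : ℤ → ℤ → ℕ → ∀ (j : (thetaIndex (pilotDataOfK T.D T.K)).Label) (vQ : (thetaIndex (pilotDataOfK T.D T.K)).VQ),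
        Set ((logShellsDH (pilotDataOfK T.D T.K) (analyticLogv T.K)).Packet j vQ))
      (ballImage : ℤ → ℤ → ∀ (j : (thetaIndex (pilotDataOfK T.D T.K)).Label) (vQ : (thetaIndex (pilotDataOfK T.D T.K)).VQ),
        Set ((logShellsDH (pilotDataOfK T.D T.K) (analyticLogv T.K)).Packet j vQ))
      (thetaDiv : ℤ → ℤ → LgpDivisor M (thetaIndex (pilotDataOfK T.D T.K)).lstar)
      (n : ℤ) {HT : Type} {LogLink : HT → HT → Type} {IsFull : ∀ {s t : HT}, LogLink s t → Prop}
      (lat : LGPGaussianLogThetaLattice LogLink IsFull)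
      {Frd : Type} {IsoF : Frd → Frd → Type} {Ob : Frd → Type} {realify : Frd → Frd} {Strip : Type}
      {IsoS : Strip → Strip → Type} {Mv : ∀ v : (thetaIndex (pilotDataOfK T.D T.K)).V, v ∈ (thetaIndex (pilotDataOfK T.D T.K)).Vbad → Type}
      [∀ v h, Monoid (Mv v h)]
      (sig : GlobalLGPFrobenioidSignature (thetaIndex (pilotDataOfK T.D T.K)).lstar (thetaIndex (pilotDataOfK T.D T.K)).V
        (· ∈ (thetaIndex (pilotDataOfK T.D T.K)).Vbad) Frd IsoF Ob realify Strip IsoS Mv)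
      (split : SplittingMonoids Mv) {ObΔ : Type}
      {N : ∀ v : (thetaIndex (pilotDataOfK T.D T.K)).V, v ∈ (thetaIndex (pilotDataOfK T.D T.K)).Vbad → Type}
      [∀ v h, Monoid (N v h)] (qData : QPilotData ObΔ N)
      (qK : ∀ v : (thetaIndex (pilotDataOfK T.D T.K)).V, v ∈ (thetaIndex (pilotDataOfK T.D T.K)).Vbad →
        Set ((logShellsDH (pilotDataOfK T.D T.K) (analyticLogv T.K)).StarPacket v)),
    ¬ Cor312Vol.PilotKummerCompatHull
        (LatticeSituation.ofShells (logShellsDH (pilotDataOfK T.D T.K) (analyticLogv T.K)) M archPk archSub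
          (summandPiecesPr (pilotDataOfK T.D T.K) (logvAnalytic_analyticLogv (F := T.K))).Adm
          (summandPiecesPr (pilotDataOfK T.D T.K) (logvAnalytic_analyticLogv (F := T.K))).logvol Ψ act Mmod region frobAdm
          frobLogvol frobΨ frobMmod unitImage ballImage thetaDiv)
        (settingPrVolSharp (pilotDataOfK T.D T.K) (logvAnalytic_analyticLogv (F := T.K)) M archPk archSub Ψ act Mmod region n
          lat sig split qData (exists_realising_qIdeles_pilotDataOfK T.D).choose (exists_realising_thetaIdeles_pilotDataOfK T.D).choose
          (exists_realising_qIdeles_pilotDataOfK T.D).choose_spec.1 (exists_realising_qIdeles_pilotDataOfK T.D).choose_spec.2.1)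
        (fun _ => Cor312.Setting.qRegion
          (settingPrVolSharp (pilotDataOfK T.D T.K) (logvAnalytic_analyticLogv (F := T.K)) M archPk archSub Ψ act Mmod region n
            lat sig split qData (exists_realising_qIdeles_pilotDataOfK T.D).choose (exists_realising_thetaIdeles_pilotDataOfK T.D).choose
            (exists_realising_qIdeles_pilotDataOfK T.D).choose_spec.1 (exists_realising_qIdeles_pilotDataOfK T.D).choose_spec.2.1))
        qK := by
  letI := T.instFieldF; letI := T.instNumberFieldF; letI := T.instAlgebraF; letI := T.instFieldK
  letI := T.instNumberFieldK; letI := T.instAlgebraK; letI := T.instFieldFbar; letI := T.instAlgebraFbar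
  letI := T.instAlgebraKFbar; letI := T.instIsElliptic
  have hp : Nat.Prime 67 := by norm_num
  have hodd : l % 2 = 1 := by
    rcases hl.eq_two_or_odd with h | h
    · omega
    · exact h
  intro M _ _ archPk archSub Ψ act Mmod region frobAdm frobLogvol frobΨ frobMmod
    unitImage ballImage thetaDiv n HT LogLink IsFull lat Frd IsoF Ob realify Strip IsoS Mv _ sig split ObΔ N _ qData qK
  exact GenuineK.not_pilotKummerCompatHull_chosen_triple_of_hullCells_tame isABCTriple_frey31117999167337103924704 T ⟨67, hp⟩ (by norm_num)
    (by norm_num) (by norm_num) (fun h => h67 h.symm) (by show (67 : ℕ) ∣ _; norm_num)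
    WRow.factorization_frey31117999167337103924704_sixtySeven (i := (l - 1) / 2 - 1) (by omega)
    (fun A h30 h15 hev => by
      obtain rfl : A = 15 := WRow.refBandClass_sixtySeven_eight h30 h15 hev
      exact WRow.refBandCells_frey31117999167337103924704_sixtySeven l h5 hhi hodd) M archPk archSub Ψ act Mmod region
    frobAdm frobLogvol frobΨ frobMmod unitImage ballImage thetaDiv n lat sig split qData qK

end Summit.ABC.IUTFork.Conditional

end
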